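import Literature.NumberTheory.EllipticCurves.BinaryQuarticTwoCoveringsLocalConic
import HarnessLib

/-!
# Two-coverings attached to binary quartic forms, XI: the twisted fixed point and the descent of
# the Möbius cocycle

Topic `Literature/NumberTheory/EllipticCurves`. Eleventh file of the theory proving the named fact
`Literature.NumberTheory.EllipticCurves.bhargavaShankar_card_selmerTwo_eq_kEquivClassCount`.
From a rational isotropic vector `v` of the conic `q_φ` (file X) we build, for a `2`-Selmer
cocycle `φ`, a `Γ_ℚ`-equivariant coordinate on the projective line twisted by the Möbius cocycle
`σ ↦ M_{φ(σ)} ∘ σ` (`M_T` = translation by `T ∈ E[2]` on `x`-coordinates), i.e. we trivialise the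
`PGL₂`-cocycle explicitly (Birch–Swinnerton-Dyer 1963, Lemma 1; Cremona 2001 §5; Cassels,
*LEC* §22):

* `§1` global Lagrange sums over `ℚ̄`: equivariant data give Galois-fixed, hence rational, sums;
* `§2` `uᵢ = v₀ + v₁eᵢ + v₂eᵢ²`, `yᵢ = δᵢuᵢ²` interpolated by `α + βX` (`α, β ∈ ℚ`; the `X²`
  coefficient is `q_φ(v) = 0`), and `zᵢ = wᵢuᵢ` with `zᵢ² = α + βeᵢ` and the twisted law
  `σ(zⱼ) = sgn · z_{κⱼ}`;
* `§3` the **twisted fixed point** `x′` (`β ≠ 0`: the half-point formula of file VII; `β = 0`: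
  a `2`-torsion abscissa), unless `φ` is identically `O`;
* `§4` the affine cocycle `(a_σ, b_σ)` of the conjugated Möbius cocycle at `x′`, its multiplicative
  trivialisation `λ` (Poincaré series over `Γ/H`, Artin independence — Hilbert 90 made explicit)
  and additive trivialisation `β₀` (average);
* `§5` the four values `ρ_t` of the equivariant coordinate `Ũ = 1/(λ(X − x′)) + β₀` at
  `t ∈ {∞, e₁, e₂, e₃}` and the **root action** `σ(ρ_t) = ρ_{κ_σ t ⊕ idx σ}`.

## References

* B. J. Birch, H. P. F. Swinnerton-Dyer, *Notes on elliptic curves. I*, J. reine angew. Math. 212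
  (1963), Lemma 1. [BirchSwinnertonDyer1963]
* J. E. Cremona, *Classical invariants and 2-descent on elliptic curves*, J. Symbolic Comput. 31
  (2001), §5. [Cremona2001]
* M. Bhargava, A. Shankar, Ann. of Math. (2) 181 (2015), Lemma 5.2 (arXiv:1006.1002v2 numbering).
  [BhargavaShankarAnnals2015]
-/

noncomputable section

open scoped Classical

universe u

namespace Literature.NumberTheory.EllipticCurves

namespace TwoCovering

open BinaryQuartic WeierstrassCurve WeierstrassCurve.Affine GaloisRepresentations
open Literature.NumberTheory.QuadraticForms

/-! ## §1 Global Lagrange sums -/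

section GLagrange

variable {AB : ℤ × ℤ} (hE : 4 * AB.1 ^ 3 + 27 * AB.2 ^ 2 ≠ 0)

/-- The global Lagrange-type sums `Σ_{j ≠ 0} ρⱼ gⱼ / F′(eⱼ)` over `ℚ̄`. [folklore] -/
def glsum (ρ g : Fin 4 → AlgebraicClosure ℚ) : AlgebraicClosure ℚ :=
  ∑ j : Fin 4, if j = 0 then 0 else ρ j * g j / (3 * eb hE j ^ 2 + algebraMap ℚ (AlgebraicClosure ℚ) (AB.1 : ℚ))

/-- Unfolding `glsum` into three terms. [folklore] -/
theorem glsum_eq (ρ g : Fin 4 → AlgebraicClosure ℚ) : glsum hE ρ g =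
    ρ 1 * g 1 / (3 * eb hE 1 ^ 2 + algebraMap ℚ (AlgebraicClosure ℚ) (AB.1 : ℚ)) +
    ρ 2 * g 2 / (3 * eb hE 2 ^ 2 + algebraMap ℚ (AlgebraicClosure ℚ) (AB.1 : ℚ)) +
    ρ 3 * g 3 / (3 * eb hE 3 ^ 2 + algebraMap ℚ (AlgebraicClosure ℚ) (AB.1 : ℚ)) := by
  rw [glsum, Fin.sum_univ_four]
  simp only [Fin.isValue, if_true, one_ne_zero, if_false, show (2 : Fin 4) ≠ 0 by decide,
    show (3 : Fin 4) ≠ 0 by decide, zero_add]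

/-- **Equivariant sums are Galois-fixed.** [folklore] -/
theorem gal_glsum (σ : Field.absoluteGaloisGroup ℚ) (ρ g : Fin 4 → AlgebraicClosure ℚ)
    (hρ : ∀ j, j ≠ 0 → gal σ (ρ j) = ρ (rootPerm hE σ j)) (hg : ∀ j, gal σ (g j) = g (rootPerm hE σ j)) :
    gal σ (glsum hE ρ g) = glsum hE ρ g := by
  rw [glsum, map_sum]
  have h0 : ∀ j, rootPerm hE σ j = 0 ↔ j = 0 := fun j ↦ by
    constructor
    · intro h; rw [← rootPerm_zero hE σ] at h; exact (rootPerm hE _).injective h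
    · rintro rfl; exact rootPerm_zero hE _
  have hterm : ∀ j, gal σ (if j = 0 then 0 else ρ j * g j / (3 * eb hE j ^ 2 + algebraMap ℚ (AlgebraicClosure ℚ) (AB.1 : ℚ))) =
      (fun j ↦ if j = 0 then 0 else ρ j * g j / (3 * eb hE j ^ 2 + algebraMap ℚ (AlgebraicClosure ℚ) (AB.1 : ℚ)))
        (rootPerm hE σ j) := by
    intro j
    by_cases hj : j = 0
    · simp only [hj, if_true, map_zero, (h0 0).mpr rfl]
    · simp only [hj, if_false, (h0 j).not.mpr hj]
      rw [map_div₀, map_mul, map_add, map_mul, map_pow, hρ j hj, hg j, gal_eb, AlgEquiv.commutes, map_ofNat]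
  simp_rw [hterm]
  exact Equiv.sum_comp (rootPerm hE σ)
    (fun j ↦ if j = 0 then 0 else ρ j * g j / (3 * eb hE j ^ 2 + algebraMap ℚ (AlgebraicClosure ℚ) (AB.1 : ℚ)))

/-- A Galois-fixed equivariant sum is rational. [folklore] -/
theorem glsum_rational (ρ g : Fin 4 → AlgebraicClosure ℚ)
    (hρ : ∀ σ j, j ≠ 0 → gal σ (ρ j) = ρ (rootPerm hE σ j)) (hg : ∀ σ j, gal σ (g j) = g (rootPerm hE σ j)) :
    ∃ q : ℚ, algebraMap ℚ (AlgebraicClosure ℚ) q = glsum hE ρ g :=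
  exists_algebraMap_eq_of_fixed ℚ _ fun σ ↦ gal_glsum hE σ ρ g (hρ σ) (hg σ)

end GLagrange

/-! ## §2 The data attached to an isotropic vector -/

section IsoData

variable {AB : ℤ × ℤ} (hE : 4 * AB.1 ^ 3 + 27 * AB.2 ^ 2 ≠ 0)
  (φ : contOneCocycles (discreteTopRep (Field.absoluteGaloisGroup ℚ) (geomTorsion (shortWeierstrass AB) 2)))
  (v : Fin 3 → ℚ)

/-- `uᵢ = v₀ + v₁ eᵢ + v₂ eᵢ²`. [folklore] -/
def uval (i : Fin 4) : AlgebraicClosure ℚ :=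
  algebraMap ℚ _ (v 0) + algebraMap ℚ _ (v 1) * eb hE i + algebraMap ℚ _ (v 2) * eb hE i ^ 2

/-- `uᵢ` is plainly equivariant: `σ(uⱼ) = u_{κⱼ}`. [folklore] -/
theorem gal_uval (σ : Field.absoluteGaloisGroup ℚ) (j : Fin 4) : gal σ (uval hE v j) = uval hE v (rootPerm hE σ j) := by
  simp only [uval, map_add, map_mul, map_pow, AlgEquiv.commutes, gal_eb]

/-- `yᵢ = δᵢ uᵢ²`. [folklore] -/
def yval (i : Fin 4) : AlgebraicClosure ℚ := delta hE φ i * uval hE v i ^ 2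

/-- `yᵢ` is plainly equivariant. [folklore] -/
theorem gal_yval (σ : Field.absoluteGaloisGroup ℚ) (j : Fin 4) : gal σ (yval hE φ v j) = yval hE φ v (rootPerm hE σ j) := by
  simp only [yval, map_mul, map_pow, gal_delta, gal_uval]

/-- **Isotropy read off the `X²`-coefficient**: `Σᵢ yᵢ / F′(eᵢ) = ι(ᵗv Q v)`. [folklore] -/
theorem glsum_yval_one : glsum hE (yval hE φ v) (fun _ ↦ 1) =
    algebraMap ℚ (AlgebraicClosure ℚ) (Matrix.toBilin' (conicMat hE φ) v v) := by
  rw [← toBilin'_map_apply (algebraMap ℚ (AlgebraicClosure ℚ)), toBilin'_conicMat_map, glsum_eq, Fin.sum_univ_three]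
  simp only [Function.comp_apply, yval, uval, mul_one, Fin.succ_zero_eq_one, Fin.succ_one_eq_two,
    show Fin.succ (2 : Fin 3) = 3 by decide]
  ring

/-- `α = Σ yⱼ (A + eⱼ²)/F′(eⱼ)` over `ℚ̄`. [folklore] -/
def alphaC : AlgebraicClosure ℚ :=
  glsum hE (yval hE φ v) (fun j ↦ algebraMap ℚ (AlgebraicClosure ℚ) (AB.1 : ℚ) + eb hE j ^ 2)

/-- `β = Σ yⱼ eⱼ/F′(eⱼ)` over `ℚ̄`. [folklore] -/
def betaC : AlgebraicClosure ℚ :=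
  glsum hE (yval hE φ v) (fun j ↦ eb hE j)

/-- `α` is rational. [folklore] -/
theorem alphaC_rational : ∃ q : ℚ, algebraMap ℚ (AlgebraicClosure ℚ) q = alphaC hE φ v :=
  glsum_rational hE _ _ (fun σ j _ ↦ gal_yval hE φ v σ j) fun σ j ↦ by rw [map_add, map_pow, AlgEquiv.commutes, gal_eb]

/-- `β` is rational. [folklore] -/
theorem betaC_rational : ∃ q : ℚ, algebraMap ℚ (AlgebraicClosure ℚ) q = betaC hE φ v :=
  glsum_rational hE _ _ (fun σ j _ ↦ gal_yval hE φ v σ j) fun σ j ↦ gal_eb hE σ j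

/-- `α`, `β` are Galois-fixed. [folklore] -/
theorem gal_alphaC (σ : Field.absoluteGaloisGroup ℚ) : gal σ (alphaC hE φ v) = alphaC hE φ v :=
  gal_glsum hE σ _ _ (fun j _ ↦ gal_yval hE φ v σ j) fun j ↦ by rw [map_add, map_pow, AlgEquiv.commutes, gal_eb]

/-- `β` is Galois-fixed. [folklore] -/
theorem gal_betaC (σ : Field.absoluteGaloisGroup ℚ) : gal σ (betaC hE φ v) = betaC hE φ v :=
  gal_glsum hE σ _ _ (fun j _ ↦ gal_yval hE φ v σ j) fun j ↦ gal_eb hE σ j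

/-- **Interpolation**: if `ᵗv Q v = 0` then `yᵢ = α + β eᵢ` for `i = 1, 2, 3`. [folklore] -/
theorem yval_eq (hvq : Matrix.toBilin' (conicMat hE φ) v v = 0) {i : Fin 4} (hi : i ≠ 0) :
    yval hE φ v i = alphaC hE φ v + betaC hE φ v * eb hE i := by
  obtain ⟨hs, hA, -⟩ := eb_vieta hE
  have h12 : eb hE 1 - eb hE 2 ≠ 0 := sub_ne_zero.mpr fun h ↦ absurd (eb_injective hE (by decide) (by decide) h) (by decide)
  have h13 : eb hE 1 - eb hE 3 ≠ 0 := sub_ne_zero.mpr fun h ↦ absurd (eb_injective hE (by decide) (by decide) h) (by decide)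
  have h23 : eb hE 2 - eb hE 3 ≠ 0 := sub_ne_zero.mpr fun h ↦ absurd (eb_injective hE (by decide) (by decide) h) (by decide)
  have hlag := lagrange_interpolate (ρ₁ := yval hE φ v 1) (ρ₂ := yval hE φ v 2) (ρ₃ := yval hE φ v 3) hs hA.symm h12 h13 h23
  dsimp only at hlag
  rw [← glsum_eq hE (yval hE φ v) (fun j ↦ algebraMap ℚ (AlgebraicClosure ℚ) (AB.1 : ℚ) + eb hE j ^ 2),
    ← glsum_eq hE (yval hE φ v) (fun j ↦ eb hE j)] at hlag
  have hc' : yval hE φ v 1 / (3 * eb hE 1 ^ 2 + algebraMap ℚ (AlgebraicClosure ℚ) (AB.1 : ℚ)) +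
      yval hE φ v 2 / (3 * eb hE 2 ^ 2 + algebraMap ℚ (AlgebraicClosure ℚ) (AB.1 : ℚ)) +
      yval hE φ v 3 / (3 * eb hE 3 ^ 2 + algebraMap ℚ (AlgebraicClosure ℚ) (AB.1 : ℚ)) = 0 := by
    have h := glsum_yval_one hE φ v
    rw [hvq, map_zero, glsum_eq] at h
    simpa only [mul_one] using h
  rw [hc'] at hlag
  simp only [zero_mul, add_zero] at hlag
  obtain ⟨hl1, hl2, hl3⟩ := hlag
  have hi' : i = 1 ∨ i = 2 ∨ i = 3 := by revert i; decide
  rcases hi' with rfl | rfl | rfl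
  · rw [← hl1]; rfl
  · rw [← hl2]; rfl
  · rw [← hl3]; rfl

/-- **The elements `zᵢ = wᵢ uᵢ`.** [folklore] -/
def zval (i : Fin 4) : AlgebraicClosure ℚ := twInv hE φ i * uval hE v i

/-- `zᵢ² = yᵢ`. [folklore] -/
theorem zval_sq (i : Fin 4) : zval hE φ v i ^ 2 = yval hE φ v i := by
  rw [zval, mul_pow, yval, delta]

/-- **The twisted law of `z`**: `σ(zⱼ) = sgn (idx σ) (κⱼ) · z_{κⱼ}`. [folklore] -/
theorem gal_zval (σ : Field.absoluteGaloisGroup ℚ) (j : Fin 4) :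
    gal σ (zval hE φ v j) = (sgn (idx hE φ σ) (rootPerm hE σ j) : AlgebraicClosure ℚ) * zval hE φ v (rootPerm hE σ j) := by
  rw [zval, map_mul, gal_uval]
  have h := gal_twInv hE φ σ (rootPerm hE σ j)
  rw [Equiv.Perm.inv_def, Equiv.symm_apply_apply] at h
  rw [h, zval]; ring

/-- If `v ≠ 0` then some `uᵢ ≠ 0` (`i = 1, 2, 3`): a nonzero quadratic has at most two roots.
[folklore] -/
theorem exists_uval_ne_zero (hv0 : v ≠ 0) : ∃ i : Fin 4, i ≠ 0 ∧ uval hE v i ≠ 0 := by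
  by_contra hall
  push Not at hall
  have h1 := hall 1 (by decide)
  have h2 := hall 2 (by decide)
  have h3 := hall 3 (by decide)
  simp only [uval] at h1 h2 h3
  have hne : ∀ {i j : Fin 4}, i ≠ 0 → j ≠ 0 → i ≠ j → eb hE i ≠ eb hE j := fun hi hj hij h ↦ hij (eb_injective hE hi hj h)
  obtain ⟨ha, hb, hc⟩ := quadratic_eq_zero_of_three_roots (α := algebraMap ℚ (AlgebraicClosure ℚ) (v 2))
    (β := algebraMap ℚ _ (v 1)) (γ := algebraMap ℚ _ (v 0)) (hne (i := 1) (j := 2) (by decide) (by decide) (by decide))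
    (hne (i := 1) (j := 3) (by decide) (by decide) (by decide)) (hne (i := 2) (j := 3) (by decide) (by decide) (by decide))
    (by linear_combination h1) (by linear_combination h2) (by linear_combination h3)
  apply hv0
  funext i
  fin_cases i
  · exact (algebraMap ℚ (AlgebraicClosure ℚ)).injective (hc.trans (map_zero _).symm)
  · exact (algebraMap ℚ (AlgebraicClosure ℚ)).injective (hb.trans (map_zero _).symm)
  · exact (algebraMap ℚ (AlgebraicClosure ℚ)).injective (ha.trans (map_zero _).symm)

end IsoData

/-! ## §3 The twisted fixed point -/

section FixedPoint

variable {AB : ℤ × ℤ} (hE : 4 * AB.1 ^ 3 + 27 * AB.2 ^ 2 ≠ 0)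
  (φ : contOneCocycles (discreteTopRep (Field.absoluteGaloisGroup ℚ) (geomTorsion (shortWeierstrass AB) 2)))

/-- **Addition of `2`-torsion points in coordinates**: `e_{m ⊕ k} = M_{T_k}(e_m)` for distinct nonzero
`m, k` (from `Tb m + Tb k = Tb (m ⊕ k)` and the translation formula). [folklore] -/
theorem eb_v4add_eq_mobT {m k : Fin 4} (hm : m ≠ 0) (hk : k ≠ 0) (hmk : m ≠ k) :
    eb hE (v4add m k) = mobT (algebraMap ℚ (AlgebraicClosure ℚ) (AB.1 : ℚ)) (eb hE k) (eb hE m) := by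
  have hs := setup_bootForm_map hE
  have hC := isShortModel_ratCast AB (AlgebraicClosure ℚ)
  have h3 : (3 : AlgebraicClosure ℚ) ≠ 0 := by norm_num
  have hmk' := v4add_ne hm hk hmk
  have hsome : ∀ {j : Fin 4}, j ≠ 0 → ∃ h, Tb hE j = Point.some (eb hE j) 0 h := fun {j} hj ↦ by
    refine ⟨?_, ?_⟩
    · exact nonsingular_torsX hC (bootData hE) hs.a_ne h3 hs.disc_ne_zero hs.t_ne hs.I_eq hs.J_eq (Ne.symm hj)
    · exact torsorPt_eq_some hC (bootData hE) hs.a_ne h3 hs.disc_ne_zero hs.t_ne hs.I_eq hs.J_eq (Ne.symm hj)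
  obtain ⟨hTm, hm'⟩ := hsome hm
  obtain ⟨hTk, hk'⟩ := hsome hk
  obtain ⟨hTmk, hmk''⟩ := hsome hmk'.1
  have hadd := Tb_v4add hE m k
  have hxe : eb hE m ≠ eb hE k := fun h ↦ hmk (eb_injective hE hm hk h)
  obtain ⟨h', hsum⟩ := some_add_torsion hC hTm hTk hxe
  rw [hm', hk', hmk''] at hadd
  exact (Point.some.inj (hadd.trans hsum)).1

/-- **Permutation invariance of a symmetric pair sum** on `{1, 2, 3}`. [folklore] -/
theorem pairSum_perm {R : Type*} [CommRing R] (c : Fin 4 → Fin 4 → R) (hc : ∀ x y, c x y = c y x) (Z : Fin 4 → R)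
    {a b d : Fin 4} (ha : a ≠ 0) (hb : b ≠ 0) (hd : d ≠ 0) (hab : a ≠ b) (had : a ≠ d) (hbd : b ≠ d) :
    c a b * Z a * Z b + c a d * Z a * Z d + c b d * Z b * Z d =
      c 1 2 * Z 1 * Z 2 + c 1 3 * Z 1 * Z 3 + c 2 3 * Z 2 * Z 3 := by
  have ha' : a = 1 ∨ a = 2 ∨ a = 3 := by clear hab had; revert a; decide
  have hb' : b = 1 ∨ b = 2 ∨ b = 3 := by clear hab hbd; revert b; decide
  have hd' : d = 1 ∨ d = 2 ∨ d = 3 := by clear had hbd; revert d; decide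
  rcases ha' with rfl | rfl | rfl <;> rcases hb' with rfl | rfl | rfl <;> rcases hd' with rfl | rfl | rfl <;> first
    | exact absurd rfl hab
    | exact absurd rfl had
    | exact absurd rfl hbd
    | ((try simp only [hc 2 1, hc 3 1, hc 3 2]) <;> ring)

/-- A sign character constant on `{1, 2, 3}` is trivial: `n = 0`. [folklore] -/
theorem eq_zero_of_sgn_const {n a b d : Fin 4} (ha : a ≠ 0) (hb : b ≠ 0) (hd : d ≠ 0) (hab : a ≠ b) (had : a ≠ d)
    (hbd : b ≠ d) (h1 : sgn n a = sgn n b) (h2 : sgn n a = sgn n d) : n = 0 := by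
  have ha' : a = 1 ∨ a = 2 ∨ a = 3 := by clear hab had h1 h2; revert a; decide
  have hb' : b = 1 ∨ b = 2 ∨ b = 3 := by clear hab hbd h1; revert b; decide
  have hd' : d = 1 ∨ d = 2 ∨ d = 3 := by clear had hbd h2; revert d; decide
  rcases ha' with rfl | rfl | rfl <;> rcases hb' with rfl | rfl | rfl <;> rcases hd' with rfl | rfl | rfl <;> first
    | exact absurd rfl hab
    | exact absurd rfl had
    | exact absurd rfl hbd
    | (revert n; decide)

/-- `v4add (v4add k m) x = 0 → x = v4add m k` in the Klein group. [folklore] -/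
theorem v4add_v4add_eq_zero {k m x : Fin 4} (h : v4add (v4add k m) x = 0) : x = v4add m k := by
  revert k m x; decide

/-- `a ⊕ k = m ↔ a = m ⊕ k` in the Klein group. [folklore] -/
theorem v4add_eq_iff (a k m : Fin 4) : v4add a k = m ↔ a = v4add m k := by revert a k m; decide

/-- Signs: `η ∈ {±1}` on `{1,2,3}` with `η 1 = 1` is `± sgn m` for some `m`. [folklore] -/
theorem exists_sgn_eq (η : Fin 4 → ℤ) (h1 : η 1 = 1) (h2 : η 2 = 1 ∨ η 2 = -1) (h3 : η 3 = 1 ∨ η 3 = -1) :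
    ∃ m : Fin 4, ∀ i, i ≠ 0 → η i = sgn m 1 * sgn m i := by
  have aux : ∀ i : Fin 4, i ≠ 0 → i = 1 ∨ i = 2 ∨ i = 3 := by decide
  rcases h2 with h2 | h2 <;> rcases h3 with h3 | h3
  · refine ⟨0, fun i hi ↦ ?_⟩
    rcases aux i hi with rfl | rfl | rfl <;> simp [sgn, h1, h2, h3]
  · refine ⟨3, fun i hi ↦ ?_⟩
    rcases aux i hi with rfl | rfl | rfl <;> simp [sgn, h1, h2, h3]
  · refine ⟨2, fun i hi ↦ ?_⟩
    rcases aux i hi with rfl | rfl | rfl <;> simp [sgn, h1, h2, h3]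
  · refine ⟨1, fun i hi ↦ ?_⟩
    rcases aux i hi with rfl | rfl | rfl <;> simp [sgn, h1, h2, h3]

/-- One case of the twisted fixed point, with the pole excluded: under `zᵢ² = α + βeᵢ`, `β ≠ 0`,
`F′(e₁) ≠ 0`, the point `x′ = −α/β − (z₁z₂ + z₁z₃ + z₂z₃)/β` is not `e₁` and its sign-changed
companion is `M_{T₁}(x′)`. [folklore] -/
theorem twFixed_case {F : Type*} [Field F] {z₁ z₂ z₃ α β e₁ e₂ e₃ A : F} (hz₁ : z₁ ^ 2 = α + β * e₁)
    (hz₂ : z₂ ^ 2 = α + β * e₂) (hz₃ : z₃ ^ 2 = α + β * e₃) (hs : e₁ + e₂ + e₃ = 0)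
    (hA : A = e₁ * e₂ + e₁ * e₃ + e₂ * e₃) (hβ : β ≠ 0) (hF : 3 * e₁ ^ 2 + A ≠ 0) :
    -α / β - (z₁ * z₂ + z₁ * z₃ + z₂ * z₃) / β ≠ e₁ ∧
      -α / β - (-(z₁ * z₂) - z₁ * z₃ + z₂ * z₃) / β =
        mobT A e₁ (-α / β - (z₁ * z₂ + z₁ * z₃ + z₂ * z₃) / β) := by
  have hid := twistedFixedPoint_identity hz₁ hz₂ hz₃ hs hA hβ
  have hne : -α / β - (z₁ * z₂ + z₁ * z₃ + z₂ * z₃) / β ≠ e₁ := by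
    intro heq
    rw [heq, sub_self, mul_zero, zero_sub, neg_eq_zero] at hid
    exact hF (by linear_combination hid)
  exact ⟨hne, twistedFixedPoint hz₁ hz₂ hz₃ hs hA hβ (sub_ne_zero.mpr hne)⟩

/-- **The twisted fixed point relation** for `x′ ∈ ℚ̄`: `x′` avoids the `2`-torsion abscissae and
`σ x′ = M_{φ(σ)}(x′)` for all `σ ∈ Γ_ℚ` (with `M_O = id`, `M_{T_k} = mobT A e_k`). [folklore] -/
def IsTwFixed (x' : AlgebraicClosure ℚ) : Prop :=
  (∀ k : Fin 4, k ≠ 0 → x' ≠ eb hE k) ∧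
  ∀ σ : Field.absoluteGaloisGroup ℚ, (idx hE φ σ = 0 → gal σ x' = x') ∧
    (idx hE φ σ ≠ 0 → gal σ x' = mobT (algebraMap ℚ (AlgebraicClosure ℚ) (AB.1 : ℚ)) (eb hE (idx hE φ σ)) x')

/-- **Existence of a twisted fixed point** (or triviality of the class of `φ`): from a nonzero rational
isotropic vector of the conic. Case `β ≠ 0`: `x′ = −α/β − (z₁z₂ + z₁z₃ + z₂z₃)/β` (file VII identity);
case `β = 0`: the signs of `zᵢ = ±z₁` determine `m` with `κ_σ m ⊕ idx σ = m` for all `σ`, i.e. `φ`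
is the coboundary of `T_m`, so `[φ] = 0`. This is the point of the twisted `ℙ¹` promised by the
point on the conic (Birch–Swinnerton-Dyer 1963, Lemma 1). [cite: BirchSwinnertonDyer1963, Lemma 1] -/
theorem exists_twFixed (v : Fin 3 → ℚ) (hv0 : v ≠ 0) (hvq : Matrix.toBilin' (conicMat hE φ) v v = 0) :
    oneCocycleClass _ φ = 0 ∨ ∃ x', IsTwFixed hE φ x' := by
  obtain ⟨hs, hA, -⟩ := eb_vieta hE
  have hz : ∀ i, i ≠ 0 → zval hE φ v i ^ 2 = alphaC hE φ v + betaC hE φ v * eb hE i := fun i hi ↦ by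
    rw [zval_sq, yval_eq hE φ v hvq hi]
  have hκ0 : ∀ (σ : Field.absoluteGaloisGroup ℚ) j, rootPerm hE σ j ≠ 0 ↔ j ≠ 0 := fun σ j ↦ by
    rw [not_iff_not]
    constructor
    · intro h; rw [← rootPerm_zero hE σ] at h; exact (rootPerm hE σ).injective h
    · rintro rfl; exact rootPerm_zero hE σ
  by_cases hβ : betaC hE φ v = 0
  · -- `β = 0`: `zᵢ² = α ≠ 0`, `zᵢ = ηᵢ z₁`
    have hα0 : alphaC hE φ v ≠ 0 := by
      intro h0
      obtain ⟨i, hi, hu⟩ := exists_uval_ne_zero hE v hv0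
      have h := hz i hi
      rw [h0, hβ, zero_mul, add_zero, pow_eq_zero_iff two_ne_zero, zval, mul_eq_zero] at h
      exact h.elim (twInv_ne_zero hE φ hi) hu
    have hz1 : zval hE φ v 1 ≠ 0 := fun h0 ↦ hα0 (by
      have h := hz 1 (by decide); rwa [h0, hβ, zero_mul, add_zero, zero_pow two_ne_zero, eq_comm] at h)
    let η : Fin 4 → ℤ := fun i ↦ if zval hE φ v i = zval hE φ v 1 then 1 else -1
    have hη : ∀ i, i ≠ 0 → zval hE φ v i = (η i : AlgebraicClosure ℚ) * zval hE φ v 1 := by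
      intro i hi
      have hsq : zval hE φ v i ^ 2 = zval hE φ v 1 ^ 2 := by rw [hz i hi, hz 1 (by decide), hβ, zero_mul, zero_mul]
      rcases sq_eq_sq_iff_eq_or_eq_neg.mp hsq with h | h
      · simp only [η, h, if_true, Int.cast_one, one_mul]
      · have hne : ¬ zval hE φ v i = zval hE φ v 1 := by
          rw [h]; intro h'; exact hz1 (by linear_combination -h' / 2)
        show zval hE φ v i = ((if zval hE φ v i = zval hE φ v 1 then 1 else -1 : ℤ) : AlgebraicClosure ℚ) * zval hE φ v 1
        rw [if_neg hne, h]; push_cast; ring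
    have hη1 : η 1 = 1 := by simp [η]
    have hηv : ∀ i, η i = 1 ∨ η i = -1 := fun i ↦ by simp only [η]; split_ifs <;> simp
    obtain ⟨m, hm⟩ := exists_sgn_eq η hη1 (hηv 2) (hηv 3)
    -- the descent relation `κ_σ m = m ⊕ idx σ`
    have hrel : ∀ σ : Field.absoluteGaloisGroup ℚ, rootPerm hE σ m = v4add m (idx hE φ σ) := by
      intro σ
      have hstar : ∀ i, i ≠ 0 → sgn (idx hE φ σ) (rootPerm hE σ i) * η (rootPerm hE σ i) =
          η i * sgn (idx hE φ σ) (rootPerm hE σ 1) * η (rootPerm hE σ 1) := by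
        intro i hi
        have h := congrArg (gal σ) (hη i hi)
        rw [map_mul, map_intCast, gal_zval, gal_zval, hη _ ((hκ0 σ i).mpr hi), hη _ ((hκ0 σ 1).mpr (by decide))] at h
        have h' : ((sgn (idx hE φ σ) (rootPerm hE σ i) * η (rootPerm hE σ i) : ℤ) : AlgebraicClosure ℚ) * zval hE φ v 1 =
            ((η i * sgn (idx hE φ σ) (rootPerm hE σ 1) * η (rootPerm hE σ 1) : ℤ) : AlgebraicClosure ℚ) * zval hE φ v 1 := by
          push_cast; linear_combination h
        exact_mod_cast mul_right_cancel₀ hz1 h'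
      -- with `η = c · sgn m`, `c = sgn m 1`
      have hsgn0 : ∀ a b : Fin 4, sgn a b ≠ 0 := fun a b ↦ by unfold sgn; split_ifs <;> decide
      have hD : ∀ i, i ≠ 0 → sgn m 1 * sgn (v4add (v4add (idx hE φ σ) m) (rootPerm hE σ m)) (rootPerm hE σ i) =
          sgn (idx hE φ σ) (rootPerm hE σ 1) * sgn m (rootPerm hE σ 1) := by
        intro i hi
        have E := hstar i hi
        rw [hm _ ((hκ0 σ i).mpr hi), hm i hi, hm _ ((hκ0 σ 1).mpr (by decide)),
          ← sgn_perm (rootPerm hE σ) (rootPerm_zero hE σ) m i] at E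
        rw [sgn_v4add, sgn_v4add]
        have Q1 := sgn_sq m 1
        have Q2 := sgn_sq (rootPerm hE σ m) (rootPerm hE σ i)
        linear_combination (sgn (rootPerm hE σ m) (rootPerm hE σ i)) * E +
          (sgn (idx hE φ σ) (rootPerm hE σ 1) * sgn m (rootPerm hE σ 1) * sgn (rootPerm hE σ m) (rootPerm hE σ i) ^ 2) * Q1 +
          (sgn (idx hE φ σ) (rootPerm hE σ 1) * sgn m (rootPerm hE σ 1)) * Q2
      have hn : v4add (v4add (idx hE φ σ) m) (rootPerm hE σ m) = 0 := by
        have hc : sgn m 1 ≠ 0 := hsgn0 m 1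
        refine eq_zero_of_sgn_const ((hκ0 σ 1).mpr (by decide)) ((hκ0 σ 2).mpr (by decide)) ((hκ0 σ 3).mpr (by decide))
          (fun h ↦ absurd ((rootPerm hE σ).injective h) (by decide)) (fun h ↦ absurd ((rootPerm hE σ).injective h) (by decide))
          (fun h ↦ absurd ((rootPerm hE σ).injective h) (by decide)) ?_ ?_
        · exact mul_left_cancel₀ hc ((hD 1 (by decide)).trans (hD 2 (by decide)).symm)
        · exact mul_left_cancel₀ hc ((hD 1 (by decide)).trans (hD 3 (by decide)).symm)
      exact v4add_v4add_eq_zero hn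
    -- `φ` is the coboundary of `T_m`
    left
    refine (oneCocycleClass_eq_zero_iff _ φ).mpr ⟨⟨Tb hE m, Tb_mem hE m⟩, fun σ ↦ Subtype.ext ?_⟩
    rw [AddSubgroupClass.coe_sub, coe_rho_apply, idx_spec hE φ σ]
    have hk : idx hE φ σ = v4add (rootPerm hE σ m) m := by
      have aux : ∀ a k m : Fin 4, a = v4add m k → k = v4add a m := by decide
      exact aux _ _ _ (hrel σ)
    have hneg : (Tb hE m : geomPoints (shortWeierstrass AB)) = -Tb hE m :=
      eq_neg_iff_add_eq_zero.mpr (Tb_add_self hE m)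
    rw [hk, Tb_v4add, smul_Tb, sub_eq_add_neg, ← hneg]
  · -- `β ≠ 0`
    right
    have hA' : algebraMap ℚ (AlgebraicClosure ℚ) (AB.1 : ℚ) = eb hE 1 * eb hE 2 + eb hE 1 * eb hE 3 + eb hE 2 * eb hE 3 := hA.symm
    -- the three relabelled instances of the fixed point identity
    obtain ⟨hne1, hfix1⟩ := twFixed_case (hz 1 (by decide)) (hz 2 (by decide)) (hz 3 (by decide)) hs hA' hβ
      (deriv_eb_ne_zero hE (i := 1) (by decide))
    obtain ⟨hne2, hfix2⟩ := twFixed_case (hz 2 (by decide)) (hz 1 (by decide)) (hz 3 (by decide))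
      (by linear_combination hs) (by rw [hA']; ring) hβ (deriv_eb_ne_zero hE (i := 2) (by decide))
    obtain ⟨hne3, hfix3⟩ := twFixed_case (hz 3 (by decide)) (hz 1 (by decide)) (hz 2 (by decide))
      (by linear_combination hs) (by rw [hA']; ring) hβ (deriv_eb_ne_zero hE (i := 3) (by decide))
    have e2 : -alphaC hE φ v / betaC hE φ v - (zval hE φ v 1 * zval hE φ v 2 + zval hE φ v 1 * zval hE φ v 3 +
        zval hE φ v 2 * zval hE φ v 3) / betaC hE φ v = -alphaC hE φ v / betaC hE φ v - (zval hE φ v 2 * zval hE φ v 1 +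
        zval hE φ v 2 * zval hE φ v 3 + zval hE φ v 1 * zval hE φ v 3) / betaC hE φ v := by ring
    have e3 : -alphaC hE φ v / betaC hE φ v - (zval hE φ v 1 * zval hE φ v 2 + zval hE φ v 1 * zval hE φ v 3 +
        zval hE φ v 2 * zval hE φ v 3) / betaC hE φ v = -alphaC hE φ v / betaC hE φ v - (zval hE φ v 3 * zval hE φ v 1 +
        zval hE φ v 3 * zval hE φ v 2 + zval hE φ v 1 * zval hE φ v 2) / betaC hE φ v := by ring
    refine ⟨-alphaC hE φ v / betaC hE φ v -
      (zval hE φ v 1 * zval hE φ v 2 + zval hE φ v 1 * zval hE φ v 3 + zval hE φ v 2 * zval hE φ v 3) / betaC hE φ v,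
      fun k hk ↦ ?_, fun σ ↦ ?_⟩
    · have hk' : k = 1 ∨ k = 2 ∨ k = 3 := by
        have : ∀ k : Fin 4, k ≠ 0 → k = 1 ∨ k = 2 ∨ k = 3 := by decide
        exact this _ hk
      rcases hk' with rfl | rfl | rfl
      · exact hne1
      · rw [e2]; exact hne2
      · rw [e3]; exact hne3
    -- the image of `x′`
    have himg : gal σ (-alphaC hE φ v / betaC hE φ v -
        (zval hE φ v 1 * zval hE φ v 2 + zval hE φ v 1 * zval hE φ v 3 + zval hE φ v 2 * zval hE φ v 3) / betaC hE φ v) =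
        -alphaC hE φ v / betaC hE φ v -
        ((sgn (idx hE φ σ) 1 * sgn (idx hE φ σ) 2 : ℤ) * zval hE φ v 1 * zval hE φ v 2 +
         (sgn (idx hE φ σ) 1 * sgn (idx hE φ σ) 3 : ℤ) * zval hE φ v 1 * zval hE φ v 3 +
         (sgn (idx hE φ σ) 2 * sgn (idx hE φ σ) 3 : ℤ) * zval hE φ v 2 * zval hE φ v 3) / betaC hE φ v := by
      rw [map_sub, map_div₀, map_div₀, map_neg, gal_alphaC, gal_betaC, map_add, map_add, map_mul, map_mul, map_mul,
        gal_zval, gal_zval, gal_zval]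
      congr 2
      have hp := pairSum_perm (fun x y ↦ ((sgn (idx hE φ σ) x * sgn (idx hE φ σ) y : ℤ) : AlgebraicClosure ℚ))
        (fun x y ↦ by push_cast; ring) (zval hE φ v) ((hκ0 σ 1).mpr (by decide)) ((hκ0 σ 2).mpr (by decide))
        ((hκ0 σ 3).mpr (by decide)) (fun h ↦ absurd ((rootPerm hE σ).injective h) (by decide))
        (fun h ↦ absurd ((rootPerm hE σ).injective h) (by decide)) (fun h ↦ absurd ((rootPerm hE σ).injective h) (by decide))
      rw [← hp]; push_cast; ring
    refine ⟨fun hk ↦ ?_, fun hk ↦ ?_⟩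
    · rw [himg, hk]
      simp [sgn]
    · have hk' : idx hE φ σ = 1 ∨ idx hE φ σ = 2 ∨ idx hE φ σ = 3 := by
        have : ∀ k : Fin 4, k ≠ 0 → k = 1 ∨ k = 2 ∨ k = 3 := by decide
        exact this _ hk
      rcases hk' with hk1 | hk2 | hk3
      · rw [hk1] at himg ⊢
        rw [himg, ← hfix1]
        simp only [show sgn (1 : Fin 4) 1 = 1 by decide, show sgn (1 : Fin 4) 2 = -1 by decide,
          show sgn (1 : Fin 4) 3 = -1 by decide]
        push_cast; ring
      · rw [hk2] at himg ⊢
        rw [himg, e2, ← hfix2]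
        simp only [show sgn (2 : Fin 4) 1 = -1 by decide, show sgn (2 : Fin 4) 2 = 1 by decide,
          show sgn (2 : Fin 4) 3 = -1 by decide]
        push_cast; ring
      · rw [hk3] at himg ⊢
        rw [himg, e3, ← hfix3]
        simp only [show sgn (3 : Fin 4) 1 = -1 by decide, show sgn (3 : Fin 4) 2 = -1 by decide,
          show sgn (3 : Fin 4) 3 = 1 by decide]
        push_cast; ring

end FixedPoint

/-! ## §4 The affine cocycle and its trivialisation -/

section Cocycle

variable {AB : ℤ × ℤ} (hE : 4 * AB.1 ^ 3 + 27 * AB.2 ^ 2 ≠ 0)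
  (φ : contOneCocycles (discreteTopRep (Field.absoluteGaloisGroup ℚ) (geomTorsion (shortWeierstrass AB) 2)))

/-- The multiplicative part `a_σ` of the affine cocycle `Y ↦ a_σ σ(Y) + b_σ` obtained by conjugating
the Möbius cocycle `M_{φ(σ)} ∘ σ` by `Y = 1/(X − x′)`: `a_σ = −F′(e_k)/(x′ − e_k)²`, `k = idx σ ≠ 0`
(`a_σ = 1` if `idx σ = 0`). [folklore] -/
def acoef (x' : AlgebraicClosure ℚ) (σ : Field.absoluteGaloisGroup ℚ) : AlgebraicClosure ℚ :=
  if idx hE φ σ = 0 then 1 else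
    -(3 * eb hE (idx hE φ σ) ^ 2 + algebraMap ℚ (AlgebraicClosure ℚ) (AB.1 : ℚ)) / (x' - eb hE (idx hE φ σ)) ^ 2

/-- The additive part `b_σ = −1/(x′ − e_k)` (`0` if `idx σ = 0`). [folklore] -/
def bcoef (x' : AlgebraicClosure ℚ) (σ : Field.absoluteGaloisGroup ℚ) : AlgebraicClosure ℚ :=
  if idx hE φ σ = 0 then 0 else -1 / (x' - eb hE (idx hE φ σ))

/-- `a_σ` depends only on `idx σ`. [folklore] -/
theorem acoef_congr (x' : AlgebraicClosure ℚ) {σ τ : Field.absoluteGaloisGroup ℚ} (h : idx hE φ σ = idx hE φ τ) :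
    acoef hE φ x' σ = acoef hE φ x' τ := by
  simp only [acoef, h]

/-- `b_σ` depends only on `idx σ`. [folklore] -/
theorem bcoef_congr (x' : AlgebraicClosure ℚ) {σ τ : Field.absoluteGaloisGroup ℚ} (h : idx hE φ σ = idx hE φ τ) :
    bcoef hE φ x' σ = bcoef hE φ x' τ := by
  simp only [bcoef, h]

/-- The root permutation fixes `0` only at `0`. [folklore] -/
theorem rootPerm_ne_zero_iff (σ : Field.absoluteGaloisGroup ℚ) (j : Fin 4) : rootPerm hE σ j ≠ 0 ↔ j ≠ 0 := by
  rw [not_iff_not]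
  constructor
  · intro h; rw [← rootPerm_zero hE σ] at h; exact (rootPerm hE σ).injective h
  · rintro rfl; exact rootPerm_zero hE σ

variable {x' : AlgebraicClosure ℚ} (hx : IsTwFixed hE φ x')
include hx

/-- `a_σ ≠ 0`. [folklore] -/
theorem acoef_ne_zero (σ : Field.absoluteGaloisGroup ℚ) : acoef hE φ x' σ ≠ 0 := by
  unfold acoef
  split_ifs with hk
  · exact one_ne_zero
  · exact div_ne_zero (neg_ne_zero.mpr (deriv_eb_ne_zero hE hk)) (pow_ne_zero _ (sub_ne_zero.mpr (hx.1 _ hk)))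

omit hx in
/-- Vieta and the factorisations of `F′` in the order `(k, l, m)` with `m = k ⊕ l`. [folklore] -/
theorem deriv_factor_klm {k l : Fin 4} (hk : k ≠ 0) (hl : l ≠ 0) (hkl : k ≠ l) :
    eb hE k + eb hE l + eb hE (v4add k l) = 0 ∧
    algebraMap ℚ (AlgebraicClosure ℚ) (AB.1 : ℚ) = -(eb hE l ^ 2 + eb hE l * eb hE k + eb hE k ^ 2) ∧
    3 * eb hE k ^ 2 + algebraMap ℚ (AlgebraicClosure ℚ) (AB.1 : ℚ) = (eb hE k - eb hE l) * (eb hE k - eb hE (v4add k l)) ∧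
    3 * eb hE l ^ 2 + algebraMap ℚ (AlgebraicClosure ℚ) (AB.1 : ℚ) = (eb hE l - eb hE k) * (eb hE l - eb hE (v4add k l)) ∧
    3 * eb hE (v4add k l) ^ 2 + algebraMap ℚ (AlgebraicClosure ℚ) (AB.1 : ℚ) =
      (eb hE (v4add k l) - eb hE k) * (eb hE (v4add k l) - eb hE l) := by
  obtain ⟨hm0, hmk, hml⟩ := v4add_ne hk hl hkl
  obtain ⟨hs, hA⟩ : eb hE k + eb hE l + eb hE (v4add k l) = 0 ∧
      eb hE k * eb hE l + eb hE k * eb hE (v4add k l) + eb hE l * eb hE (v4add k l) =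
        algebraMap ℚ (AlgebraicClosure ℚ) (AB.1 : ℚ) := by
    obtain ⟨hs0, hA0, -⟩ := eb_vieta hE
    have aux : ∀ j : Fin 4, j ≠ 0 → j = 1 ∨ j = 2 ∨ j = 3 := by decide
    rcases aux k hk with rfl | rfl | rfl <;> rcases aux l hl with rfl | rfl | rfl <;> first
      | exact absurd rfl hkl
      | (simp only [show v4add (1 : Fin 4) 2 = 3 by decide, show v4add (1 : Fin 4) 3 = 2 by decide,
          show v4add (2 : Fin 4) 1 = 3 by decide, show v4add (2 : Fin 4) 3 = 1 by decide,
          show v4add (3 : Fin 4) 1 = 2 by decide, show v4add (3 : Fin 4) 2 = 1 by decide]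
         exact ⟨by linear_combination hs0, by linear_combination hA0⟩)
  have hA' : algebraMap ℚ (AlgebraicClosure ℚ) (AB.1 : ℚ) = -(eb hE l ^ 2 + eb hE l * eb hE k + eb hE k ^ 2) := by
    have := A_eq_of_vieta hs hA; linear_combination this
  obtain ⟨h1, h2, h3⟩ := deriv_factor hs hA.symm
  exact ⟨hs, hA', h1, h2, h3⟩

omit hx in
/-- `σ(a_τ)` in closed form. [folklore] -/
theorem gal_acoef (σ τ : Field.absoluteGaloisGroup ℚ) : gal σ (acoef hE φ x' τ) =
    if idx hE φ τ = 0 then 1 else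
      -(3 * eb hE (rootPerm hE σ (idx hE φ τ)) ^ 2 + algebraMap ℚ (AlgebraicClosure ℚ) (AB.1 : ℚ)) /
        (gal σ x' - eb hE (rootPerm hE σ (idx hE φ τ))) ^ 2 := by
  unfold acoef
  split_ifs with hl
  · exact map_one _
  · rw [map_div₀, map_neg, map_add, map_mul, map_pow, map_pow, map_sub, gal_eb, AlgEquiv.commutes, map_ofNat]

omit hx in
/-- `σ(b_τ)` in closed form. [folklore] -/
theorem gal_bcoef (σ τ : Field.absoluteGaloisGroup ℚ) : gal σ (bcoef hE φ x' τ) =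
    if idx hE φ τ = 0 then 0 else -1 / (gal σ x' - eb hE (rootPerm hE σ (idx hE φ τ))) := by
  unfold bcoef
  split_ifs with hl
  · exact map_zero _
  · rw [map_div₀, map_neg, map_one, map_sub, gal_eb]

/-- **The multiplicative cocycle identity** `a_{στ} = a_σ · σ(a_τ)` (composition of the affine maps
`Y ↦ a Y + b` conjugate to `M_{φ(σ)} ∘ σ`; verified on the closed forms through the translation
formulas `M_k(x′) − e_k = F′(e_k)/(x′ − e_k)`, `M_k(x′) − e_l = (e_k − e_l)(x′ − e_m)/(x′ − e_k)`).
[folklore] -/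
theorem acoef_mul (σ τ : Field.absoluteGaloisGroup ℚ) :
    acoef hE φ x' (σ * τ) = acoef hE φ x' σ * gal σ (acoef hE φ x' τ) := by
  obtain ⟨hfixσ, hmovσ⟩ := hx.2 σ
  rw [gal_acoef hE φ, acoef, acoef, idx_mul]
  by_cases hk : idx hE φ σ = 0
  · rw [hk, zero_v4add, if_pos rfl, one_mul, hfixσ hk]
    by_cases hl : idx hE φ τ = 0
    · rw [hl, rootPerm_zero, if_pos rfl]
    · rw [if_neg ((rootPerm_ne_zero_iff hE σ _).mpr hl), if_neg hl]
  · have hσx := hmovσ hk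
    have hxk : x' ≠ eb hE (idx hE φ σ) := hx.1 _ hk
    have hxk' : x' - eb hE (idx hE φ σ) ≠ 0 := sub_ne_zero.mpr hxk
    rw [if_neg hk]
    by_cases hl : idx hE φ τ = 0
    · rw [hl, rootPerm_zero, v4add_zero, if_neg hk, if_pos rfl, mul_one]
    · have hl' : rootPerm hE σ (idx hE φ τ) ≠ 0 := (rootPerm_ne_zero_iff hE σ _).mpr hl
      rw [if_neg hl, hσx]
      by_cases hkl : rootPerm hE σ (idx hE φ τ) = idx hE φ σ
      · rw [hkl, v4add_self, if_pos rfl, mobT_sub_self _ _ _ hxk']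
        have hF := deriv_eb_ne_zero hE hk
        field_simp
      · obtain ⟨hs, hA', hFk, hFl, hFm⟩ := deriv_factor_klm hE hk hl' (Ne.symm hkl)
        obtain ⟨hm0, hmk, hml⟩ := v4add_ne hk hl' (Ne.symm hkl)
        rw [if_neg hm0, mobT_sub_other hxk' hA', hFk, hFl, hFm,
          show x' + eb hE (rootPerm hE σ (idx hE φ τ)) + eb hE (idx hE φ σ) =
            x' - eb hE (v4add (idx hE φ σ) (rootPerm hE σ (idx hE φ τ))) by linear_combination hs]
        have hxm : x' - eb hE (v4add (idx hE φ σ) (rootPerm hE σ (idx hE φ τ))) ≠ 0 := sub_ne_zero.mpr (hx.1 _ hm0)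
        have hkl' : eb hE (idx hE φ σ) - eb hE (rootPerm hE σ (idx hE φ τ)) ≠ 0 :=
          sub_ne_zero.mpr fun h ↦ hkl (eb_injective hE hl' hk h.symm)
        field_simp
        ring

/-- **The additive cocycle identity** `b_{στ} = a_σ · σ(b_τ) + b_σ`. [folklore] -/
theorem bcoef_mul (σ τ : Field.absoluteGaloisGroup ℚ) :
    bcoef hE φ x' (σ * τ) = acoef hE φ x' σ * gal σ (bcoef hE φ x' τ) + bcoef hE φ x' σ := by
  obtain ⟨hfixσ, hmovσ⟩ := hx.2 σ
  rw [gal_bcoef hE φ, acoef, bcoef, bcoef, idx_mul]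
  by_cases hk : idx hE φ σ = 0
  · rw [hk, zero_v4add, if_pos rfl, if_pos rfl, one_mul, add_zero, hfixσ hk]
    by_cases hl : idx hE φ τ = 0
    · rw [hl, rootPerm_zero, if_pos rfl]
    · rw [if_neg ((rootPerm_ne_zero_iff hE σ _).mpr hl), if_neg hl]
  · have hσx := hmovσ hk
    have hxk : x' ≠ eb hE (idx hE φ σ) := hx.1 _ hk
    have hxk' : x' - eb hE (idx hE φ σ) ≠ 0 := sub_ne_zero.mpr hxk
    rw [if_neg hk, if_neg hk]
    by_cases hl : idx hE φ τ = 0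
    · rw [hl, rootPerm_zero, v4add_zero, if_neg hk, if_pos rfl, mul_zero, zero_add]
    · have hl' : rootPerm hE σ (idx hE φ τ) ≠ 0 := (rootPerm_ne_zero_iff hE σ _).mpr hl
      rw [if_neg hl, hσx]
      have hF := deriv_eb_ne_zero hE hk
      by_cases hkl : rootPerm hE σ (idx hE φ τ) = idx hE φ σ
      · rw [hkl, v4add_self, if_pos rfl, mobT_sub_self _ _ _ hxk']
        field_simp
        ring
      · obtain ⟨hs, hA', hFk, hFl, hFm⟩ := deriv_factor_klm hE hk hl' (Ne.symm hkl)
        obtain ⟨hm0, hmk, hml⟩ := v4add_ne hk hl' (Ne.symm hkl)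
        rw [if_neg hm0, mobT_sub_other hxk' hA', hFk,
          show x' + eb hE (rootPerm hE σ (idx hE φ τ)) + eb hE (idx hE φ σ) =
            x' - eb hE (v4add (idx hE φ σ) (rootPerm hE σ (idx hE φ τ))) by linear_combination hs]
        have hxm : x' - eb hE (v4add (idx hE φ σ) (rootPerm hE σ (idx hE φ τ))) ≠ 0 := sub_ne_zero.mpr (hx.1 _ hm0)
        have hkl' : eb hE (idx hE φ σ) - eb hE (rootPerm hE σ (idx hE φ τ)) ≠ 0 :=
          sub_ne_zero.mpr fun h ↦ hkl (eb_injective hE hl' hk h.symm)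
        field_simp
        ring

/-! ### The open subgroup `H₂ = H_φ ∩ Stab(x′)` and the multiplicative trivialisation `λ` -/

omit hx in
/-- The stabiliser of `x′` in `Γ_ℚ`. [folklore] -/
def stabGal (x' : AlgebraicClosure ℚ) : Subgroup (Field.absoluteGaloisGroup ℚ) where
  carrier := {σ | gal σ x' = x'}
  one_mem' := rfl
  mul_mem' {a b} ha hb := by
    change gal (a * b) x' = x'
    rw [gal_mul_apply, show gal b x' = x' from hb, show gal a x' = x' from ha]
  inv_mem' {a} ha := by
    change gal a⁻¹ x' = x'
    have h : gal (a⁻¹ * a) x' = x' := by rw [inv_mul_cancel]; rfl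
    rw [gal_mul_apply, show gal a x' = x' from ha] at h
    exact h

omit hx in
/-- **The subgroup `H₂ = H_φ ∩ Stab(x′)`** (open, of finite index). [folklore] -/
def H2 (x' : AlgebraicClosure ℚ) : Subgroup (Field.absoluteGaloisGroup ℚ) := fqKer hE φ ⊓ stabGal x'

omit hx in
/-- `H₂` is open. [folklore] -/
theorem isOpen_H2 (x' : AlgebraicClosure ℚ) : IsOpen (H2 hE φ x' : Set (Field.absoluteGaloisGroup ℚ)) := by
  rw [H2, Subgroup.coe_inf]
  exact (isOpen_fqKer hE φ).inter (isOpen_setOf_apply_eq (Algebra.IsIntegral.isIntegral x') x')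

omit hx in
/-- The finite quotient `Γ_ℚ ⧸ H₂`. [folklore] -/
instance fintype_quotient_H2 (x' : AlgebraicClosure ℚ) : Fintype (Field.absoluteGaloisGroup ℚ ⧸ H2 hE φ x') :=
  @Fintype.ofFinite _ (Subgroup.quotient_finite_of_isOpen _ (isOpen_H2 hE φ x'))

omit hx in
/-- Members of `H₂` have `idx = 0`, trivial root permutation and fix `x′`. [folklore] -/
theorem mem_H2 {x' : AlgebraicClosure ℚ} {h : Field.absoluteGaloisGroup ℚ} (hh : h ∈ H2 hE φ x') :
    h ∈ fqKer hE φ ∧ gal h x' = x' := ⟨hh.1, hh.2⟩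

omit hx in
/-- **The Poincaré series** `λ(θ) = Σ_{q ∈ Γ/H₂} a_{q̃} · q̃(θ)` for `θ` in the fixed field of `H₂`.
[folklore] -/
def lamOf (x' : AlgebraicClosure ℚ) (θ : IntermediateField.fixedField (H2 hE φ x')) : AlgebraicClosure ℚ :=
  ∑ q : Field.absoluteGaloisGroup ℚ ⧸ H2 hE φ x', acoef hE φ x' q.out * gal q.out (θ : AlgebraicClosure ℚ)

/-- **`λ` trivialises the multiplicative cocycle**: `σ(λ) = a_σ⁻¹ λ`. [folklore] -/
theorem gal_lamOf (σ : Field.absoluteGaloisGroup ℚ) (θ : IntermediateField.fixedField (H2 hE φ x')) :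
    gal σ (lamOf hE φ x' θ) = (acoef hE φ x' σ)⁻¹ * lamOf hE φ x' θ := by
  rw [lamOf, map_sum, Finset.mul_sum]
  have key : ∀ q : Field.absoluteGaloisGroup ℚ ⧸ H2 hE φ x',
      gal σ (acoef hE φ x' q.out * gal q.out (θ : AlgebraicClosure ℚ)) =
        (acoef hE φ x' σ)⁻¹ * (acoef hE φ x' (σ • q).out * gal (σ • q).out (θ : AlgebraicClosure ℚ)) := by
    intro q
    obtain ⟨h, hh⟩ := QuotientGroup.mk_out_eq_mul (H2 hE φ x') (σ * q.out)
    have hσq : (σ • q) = (QuotientGroup.mk (σ * q.out) : Field.absoluteGaloisGroup ℚ ⧸ H2 hE φ x') := by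
      conv_lhs => rw [← QuotientGroup.out_eq' q]
      rfl
    obtain ⟨hh1, hh2⟩ := mem_H2 hE φ h.2
    have ha : acoef hE φ x' (σ • q).out = acoef hE φ x' (σ * q.out) := by
      rw [hσq, hh]; exact acoef_congr hE φ x' (idx_mul_of_mem hE φ _ hh1)
    have hθ : gal (σ • q).out (θ : AlgebraicClosure ℚ) = gal σ (gal q.out (θ : AlgebraicClosure ℚ)) := by
      rw [hσq, hh, gal_mul_apply, gal_mul_apply]
      congr 1; congr 1
      exact θ.2 h
    rw [map_mul, ha, hθ, acoef_mul hE φ hx]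
    field_simp [acoef_ne_zero hE φ hx σ]
  simp_rw [key]
  exact Fintype.sum_equiv (MulAction.toPerm σ) _ _ fun q ↦ rfl

/-- **Some Poincaré series is nonzero** (Artin independence of the coset embeddings). [folklore] -/
theorem exists_lamOf_ne_zero : ∃ θ : IntermediateField.fixedField (H2 hE φ x'), lamOf hE φ x' θ ≠ 0 := by
  by_contra hall
  push Not at hall
  have hclosed : IsClosed ((H2 hE φ x' : Subgroup (Field.absoluteGaloisGroup ℚ)) : Set (Field.absoluteGaloisGroup ℚ)) :=
    Subgroup.isClosed_of_isOpen _ (isOpen_H2 hE φ x')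
  have hli := linearIndependent_cosetEmb ℚ (H2 hE φ x') hclosed
  set q₁ : Field.absoluteGaloisGroup ℚ ⧸ H2 hE φ x' := QuotientGroup.mk 1 with hq₁
  have h0 := linearIndependent_iff'.mp hli (Finset.univ : Finset (Field.absoluteGaloisGroup ℚ ⧸ H2 hE φ x'))
    (fun q ↦ acoef hE φ x' q.out) ?_ q₁ (Finset.mem_univ q₁)
  · exact acoef_ne_zero hE φ hx _ h0
  · funext θ
    simp only [Finset.sum_apply, Pi.smul_apply, smul_eq_mul, Pi.zero_apply]
    exact hall θ

/-- **The multiplicative trivialisation** `Λ ≠ 0` with `σ(Λ) = a_σ⁻¹ Λ`. [folklore] -/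
def Lam : AlgebraicClosure ℚ := lamOf hE φ x' (Classical.choose (exists_lamOf_ne_zero hE φ hx))

/-- `Λ ≠ 0`. [folklore] -/
theorem Lam_ne_zero : Lam hE φ hx ≠ 0 := Classical.choose_spec (exists_lamOf_ne_zero hE φ hx)

/-- `σ(Λ) = a_σ⁻¹ Λ`. [folklore] -/
theorem gal_Lam (σ : Field.absoluteGaloisGroup ℚ) : gal σ (Lam hE φ hx) = (acoef hE φ x' σ)⁻¹ * Lam hE φ hx :=
  gal_lamOf hE φ hx σ _

/-! ### The additive trivialisation `β₀` -/

/-- The normalised additive cocycle `b′_σ = b_σ / Λ`. [folklore] -/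
def bprime (σ : Field.absoluteGaloisGroup ℚ) : AlgebraicClosure ℚ := bcoef hE φ x' σ / Lam hE φ hx

/-- **Additive cocycle identity** `b′_{στ} = b′_σ + σ(b′_τ)`. [folklore] -/
theorem bprime_mul (σ τ : Field.absoluteGaloisGroup ℚ) :
    bprime hE φ hx (σ * τ) = bprime hE φ hx σ + gal σ (bprime hE φ hx τ) := by
  rw [bprime, bprime, bprime, map_div₀, gal_Lam hE φ hx, bcoef_mul hE φ hx]
  have ha := acoef_ne_zero hE φ hx σ
  have hL := Lam_ne_zero hE φ hx
  field_simp
  ring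

/-- **The additive trivialisation** `β₀ = −(1/n) Σ_{q ∈ Γ/H₂} b′_{q̃}`. [folklore] -/
def beta0 : AlgebraicClosure ℚ :=
  -((Fintype.card (Field.absoluteGaloisGroup ℚ ⧸ H2 hE φ x') : AlgebraicClosure ℚ)⁻¹ *
    ∑ q : Field.absoluteGaloisGroup ℚ ⧸ H2 hE φ x', bprime hE φ hx q.out)

/-- **`β₀` trivialises the additive cocycle**: `σ(β₀) = β₀ + b′_σ`. [folklore] -/
theorem gal_beta0 (σ : Field.absoluteGaloisGroup ℚ) : gal σ (beta0 hE φ hx) = beta0 hE φ hx + bprime hE φ hx σ := by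
  have hn : ((Fintype.card (Field.absoluteGaloisGroup ℚ ⧸ H2 hE φ x') : AlgebraicClosure ℚ)) ≠ 0 :=
    Nat.cast_ne_zero.mpr Fintype.card_ne_zero
  rw [beta0, map_neg, map_mul, map_inv₀, map_natCast, map_sum]
  have key : ∀ q : Field.absoluteGaloisGroup ℚ ⧸ H2 hE φ x',
      gal σ (bprime hE φ hx q.out) = bprime hE φ hx (σ • q).out - bprime hE φ hx σ := by
    intro q
    obtain ⟨h, hh⟩ := QuotientGroup.mk_out_eq_mul (H2 hE φ x') (σ * q.out)
    have hσq : (σ • q) = (QuotientGroup.mk (σ * q.out) : Field.absoluteGaloisGroup ℚ ⧸ H2 hE φ x') := by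
      conv_lhs => rw [← QuotientGroup.out_eq' q]
      rfl
    obtain ⟨hh1, -⟩ := mem_H2 hE φ h.2
    have hb : bprime hE φ hx (σ • q).out = bprime hE φ hx (σ * q.out) := by
      rw [hσq, hh, bprime, bprime, bcoef_congr hE φ x' (idx_mul_of_mem hE φ _ hh1)]
    rw [hb, bprime_mul hE φ hx]; ring
  simp_rw [key]
  rw [Finset.sum_sub_distrib, Finset.sum_const, Finset.card_univ, nsmul_eq_mul]
  have hre : ∑ q : Field.absoluteGaloisGroup ℚ ⧸ H2 hE φ x', bprime hE φ hx (σ • q).out =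
      ∑ q : Field.absoluteGaloisGroup ℚ ⧸ H2 hE φ x', bprime hE φ hx q.out :=
    Fintype.sum_equiv (MulAction.toPerm σ) _ _ fun q ↦ rfl
  rw [hre]
  field_simp
  ring

/-! ## §5 The four values of the equivariant coordinate and the root action -/

/-- **The four roots** `ρ_t = Ũ(t)`, `Ũ(X) = 1/(Λ(X − x′)) + β₀`, at `t = ∞` (`ρ₀ = β₀`) and `t = eᵢ`.
[folklore] -/
def rho (t : Fin 4) : AlgebraicClosure ℚ :=
  if t = 0 then beta0 hE φ hx else (Lam hE φ hx * (eb hE t - x'))⁻¹ + beta0 hE φ hx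

/-- `ρ₀ = β₀`. [folklore] -/
theorem rho_zero : rho hE φ hx 0 = beta0 hE φ hx := if_pos rfl

/-- `ρ_t` for `t ≠ 0`. [folklore] -/
theorem rho_of_ne {t : Fin 4} (ht : t ≠ 0) : rho hE φ hx t = (Lam hE φ hx * (eb hE t - x'))⁻¹ + beta0 hE φ hx := if_neg ht

/-- **The root action**: `σ(ρ_t) = ρ_{κ_σ t ⊕ idx σ}` — the equivariant coordinate `Ũ` carries the
twisted action `t ↦ M_{φ(σ)}(σ t)` on `{∞, e₁, e₂, e₃}` to the Galois action on the `ρ_t`.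
[folklore] -/
theorem gal_rho (σ : Field.absoluteGaloisGroup ℚ) (t : Fin 4) :
    gal σ (rho hE φ hx t) = rho hE φ hx (v4add (rootPerm hE σ t) (idx hE φ σ)) := by
  obtain ⟨hfixσ, hmovσ⟩ := hx.2 σ
  have hL := Lam_ne_zero hE φ hx
  have ha := acoef_ne_zero hE φ hx σ
  have hb0 : gal σ (beta0 hE φ hx) = beta0 hE φ hx + bcoef hE φ x' σ / Lam hE φ hx := gal_beta0 hE φ hx σ
  by_cases ht : t = 0
  · -- `t = ∞`
    rw [ht, rootPerm_zero, zero_v4add, rho_zero, hb0, bcoef]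
    by_cases hk : idx hE φ σ = 0
    · rw [hk, if_pos rfl, zero_div, add_zero, rho_zero]
    · rw [if_neg hk, rho_of_ne hE φ hx hk]
      have hxk : x' - eb hE (idx hE φ σ) ≠ 0 := sub_ne_zero.mpr (hx.1 _ hk)
      have hxk' : eb hE (idx hE φ σ) - x' ≠ 0 := fun h ↦ hxk (by linear_combination -h)
      field_simp
      ring
  · -- `t = e_t`
    have hκt : rootPerm hE σ t ≠ 0 := (rootPerm_ne_zero_iff hE σ t).mpr ht
    have hxt' : eb hE t - x' ≠ 0 := fun h ↦ hx.1 _ ht (by linear_combination -h)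
    rw [rho_of_ne hE φ hx ht, map_add, hb0, map_inv₀, map_mul, gal_Lam hE φ hx, map_sub, gal_eb]
    by_cases hk : idx hE φ σ = 0
    · rw [hfixσ hk, hk, v4add_zero, rho_of_ne hE φ hx hκt, acoef, bcoef, if_pos hk, if_pos hk, inv_one, one_mul, zero_div,
        add_zero]
    · rw [hmovσ hk, acoef, bcoef, if_neg hk, if_neg hk]
      have hxk : x' - eb hE (idx hE φ σ) ≠ 0 := sub_ne_zero.mpr (hx.1 _ hk)
      have hF := deriv_eb_ne_zero hE hk
      by_cases hkt : rootPerm hE σ t = idx hE φ σ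
      · -- lands at `∞`
        have h1 := mobT_sub_self (algebraMap ℚ (AlgebraicClosure ℚ) (AB.1 : ℚ)) (eb hE (idx hE φ σ)) x' hxk
        rw [hkt, v4add_self, rho_zero,
          show eb hE (idx hE φ σ) - mobT (algebraMap ℚ (AlgebraicClosure ℚ) (AB.1 : ℚ)) (eb hE (idx hE φ σ)) x' =
            -((3 * eb hE (idx hE φ σ) ^ 2 + algebraMap ℚ (AlgebraicClosure ℚ) (AB.1 : ℚ)) / (x' - eb hE (idx hE φ σ))) by
            rw [← h1]; ring]
        field_simp
        ring
      · obtain ⟨hs, hA', hFk, hFl, hFm⟩ := deriv_factor_klm hE hk hκt (Ne.symm hkt)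
        obtain ⟨hm0, hmk, hml⟩ := v4add_ne hk hκt (Ne.symm hkt)
        have h2 := mobT_sub_other hxk hA'
        rw [show x' + eb hE (rootPerm hE σ t) + eb hE (idx hE φ σ) = x' - eb hE (v4add (idx hE φ σ) (rootPerm hE σ t)) by
          linear_combination hs] at h2
        rw [v4add_comm, rho_of_ne hE φ hx hm0,
          show eb hE (rootPerm hE σ t) - mobT (algebraMap ℚ (AlgebraicClosure ℚ) (AB.1 : ℚ)) (eb hE (idx hE φ σ)) x' =
            -((eb hE (idx hE φ σ) - eb hE (rootPerm hE σ t)) * (x' - eb hE (v4add (idx hE φ σ) (rootPerm hE σ t))) /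
              (x' - eb hE (idx hE φ σ))) by rw [← h2]; ring,
          hFk]
        have hxm : x' - eb hE (v4add (idx hE φ σ) (rootPerm hE σ t)) ≠ 0 := sub_ne_zero.mpr (hx.1 _ hm0)
        have hxm' : eb hE (v4add (idx hE φ σ) (rootPerm hE σ t)) - x' ≠ 0 := fun h ↦ hxm (by linear_combination -h)
        have hkl : eb hE (idx hE φ σ) - eb hE (rootPerm hE σ t) ≠ 0 :=
          sub_ne_zero.mpr fun h ↦ hkt (eb_injective hE hκt hk h.symm)
        have hkm : eb hE (idx hE φ σ) - eb hE (v4add (idx hE φ σ) (rootPerm hE σ t)) ≠ 0 :=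
          sub_ne_zero.mpr fun h ↦ hmk (eb_injective hE hm0 hk h.symm)
        field_simp
        ring

/-- **The `ρ_t` are distinct.** [folklore] -/
theorem rho_injective : Function.Injective (rho hE φ hx) := by
  have hL := Lam_ne_zero hE φ hx
  intro s t hst
  by_contra hne
  by_cases hs : s = 0
  · have ht : t ≠ 0 := fun h ↦ hne (hs.trans h.symm)
    rw [hs, rho_zero, rho_of_ne hE φ hx ht, eq_comm, add_eq_right, inv_eq_zero, mul_eq_zero] at hst
    exact hst.elim hL fun h ↦ hx.1 _ ht (by linear_combination -h)
  · by_cases ht : t = 0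
    · rw [ht, rho_zero, rho_of_ne hE φ hx hs, add_eq_right, inv_eq_zero, mul_eq_zero] at hst
      exact hst.elim hL fun h ↦ hx.1 _ hs (by linear_combination -h)
    · rw [rho_of_ne hE φ hx hs, rho_of_ne hE φ hx ht, add_left_inj, inv_inj, mul_right_inj' hL, sub_left_inj] at hst
      exact hne (eb_injective hE hs ht hst)

end Cocycle

end TwoCovering

end Literature.NumberTheory.EllipticCurves
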